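import Literature.IUT.HodgeTheaters.DiscreteProfiniteConjugatesProofs
import Literature.IUT.HodgeTheaters.ProfiniteCompletionQuotients
import Mathlib.Algebra.Group.Conj
import HarnessLib

/-!
# [IUTchI] Theorem 2.6 and Lemma 2.7 (v): proofs in the profinite completion (partial)

Mochizuki, *Inter-universal Teichmüller theory I*, kurims manuscript (May 2020), §2, Theorem 2.6
"Profinite Conjugates of Discrete Subgroups", p. 56, proof pp. 56–57, and Lemma 2.7 (v), p. 57, proof
p. 59 [cite: Mochizuki2012, Thm 2.6 pp.56-57].  Proof-only companion of `DiscreteProfiniteConjugates`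
(named statements `ProfiniteConjugatesOfDiscreteSubgroups`, `FreeOrSurface.zHatQuotientNormallyTerminal`)
over the completion plumbing of `ProfiniteCompletionQuotients` (abc-iut-L5-t17).  What is PROVED here:

* `normalizer_le_centralizer_of_injOn` / `normalizer_eq_centralizer_of_injOn` — the formal first step
  of the proof of Lemma 2.7 (v) (p. 59: "By considering the surjection `Ĝ ↠ ℤ̂`, we conclude
  immediately that the normalizer `N_Ĝ(T̂)` of `T̂` in `Ĝ` is equal to the centralizer `Z_Ĝ(T̂)`"),
  in any group: a subgroup on which some homomorphism to a commutative group is injective has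
  normalizer = centralizer;
* `conj_map_eq_of_isCyclic_of_conjSeparable` — the CORE of Theorem 2.6 (a) in the case `H_G` cyclic,
  for an arbitrary group `F` with a finite index subgroup `G` that is CONJUGACY SEPARABLE (p. 57:
  "Since `G` is conjugacy separable, it follows that `γ · H_G · γ⁻¹ = ε · H_G · ε⁻¹` for some
  `ε ∈ G`"): if `γ ∈ F̂` conjugates `η(H_G)` into `η(F)` then `γ · η(H_G) · γ⁻¹ = η(δ) · η(H_G) · η(δ)⁻¹`
  for some `δ ∈ F`.  The proof multiplies `γ` by an element of `η(F)` to make its component at the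
  normal core of `G` trivial (p. 57: "by multiplying `γ` on the left by an appropriate element of `F`,
  we may assume that `γ ∈ Ĝ`"), reads off that the conjugating element then has all components in
  `G`, so that `h₀` (a generator of `H_G`) and `g' ∈ G` are conjugate in EVERY finite quotient of `G`,
  and applies conjugacy separability;
* `profiniteConjugates_a_abelian_freeCase_of_conjSeparable` — **Theorem 2.6 (a) for `H_G` abelian and
  `G` free of finite rank**, relative to the conjugacy separability of free groups ([Stb1] Thm 1, the
  named input being proved by abc-iut-L5-t14 in the shape `FreeGroup.exists_normal_finiteIndex_not_isConj`):
  `H_G` abelian ⇒ cyclic by Lemma 2.7 (iv) (free case, `abelianSubgroupCyclic_freeCase`).  This is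
  the case in which Corollary 2.8 is applied in [IUTchI] (cuspidal inertia groups, Remark 2.8.1), and
  the argument does not pass through Lemma 2.7 (v).

NOT proved here (honest remainder): Lemma 2.7 (v) proper (`Z_Ĝ(T̂) = T̂`: cohomological dimension
of closed subgroups of free profinite / profinite surface groups), (vi), Theorem 2.6 (a) for
nonabelian `H_G` and (b) (both use (v)), and every orientable-surface-group input.  No new definitions.
-/

namespace Literature.IUT.HodgeTheaters

open scoped Pointwise

universe u

/-! ### Lemma 2.7 (v), first step: normalizer = centralizer -/

/-- If a homomorphism `φ : P → A` to a commutative group is injective on a subgroup `T`, then every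
element normalizing `T` centralizes it: `g t g⁻¹ ∈ T` has the same image as `t` under `φ`
(p. 59, first sentence of the proof of Lemma 2.7 (v)). [cite: Mochizuki2012, Lem 2.7(v) p.59] -/
theorem normalizer_le_centralizer_of_injOn {P : Type u} [Group P] {A : Type*} [Group A]
    (hA : ∀ a b : A, a * b = b * a) (φ : P →* A) (T : Subgroup P) (hφ : Set.InjOn φ T) :
    Subgroup.normalizer (T : Set P) ≤ Subgroup.centralizer (T : Set P) := by
  intro g hg
  rw [Subgroup.mem_centralizer_iff]
  intro t ht
  rw [Subgroup.mem_set_normalizer_iff] at hg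
  have hgt : g * t * g⁻¹ ∈ T := (hg t).mp ht
  have himg : φ (g * t * g⁻¹) = φ t := by
    rw [map_mul, map_mul, map_inv, hA (φ g) (φ t), mul_assoc, mul_inv_cancel, mul_one]
  have heq : g * t * g⁻¹ = t := hφ hgt ht himg
  calc t * g = g * t * g⁻¹ * g := by rw [heq]
    _ = g * t := by group

/-- Under the same hypothesis the normalizer of `T` EQUALS its centralizer ("we conclude immediately
that the normalizer `N_Ĝ(T̂)` … is equal to the centralizer `Z_Ĝ(T̂)`", p. 59). [cite: Mochizuki2012, Lem 2.7(v) p.59] -/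
theorem normalizer_eq_centralizer_of_injOn {P : Type u} [Group P] {A : Type*} [Group A]
    (hA : ∀ a b : A, a * b = b * a) (φ : P →* A) (T : Subgroup P) (hφ : Set.InjOn φ T) :
    Subgroup.normalizer (T : Set P) = Subgroup.centralizer (T : Set P) :=
  le_antisymm (normalizer_le_centralizer_of_injOn hA φ T hφ) (Subgroup.centralizer_le_normalizer _)

/-- `ℤ̂` is commutative (componentwise in the finite quotients `ℤ/N`). [cite: Mochizuki2012, Lem 2.7(v) p.57] -/
theorem ZHat.mul_comm (a b : ZHat) : a * b = b * a := by
  apply Subtype.ext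
  funext N
  change a.val N * b.val N = b.val N * a.val N
  have key : ∀ p q : Multiplicative ℤ ⧸ N.toSubgroup, p * q = q * p := fun p q => _root_.mul_comm p q
  exact key (a.val N) (b.val N)

/-- Reduction for **Lemma 2.7 (v)**: by `normalizer_eq_centralizer_of_injOn` (with `ℤ̂` commutative and
`Ĝ ↠ ℤ̂` injective on `T̂`), the named statement `zHatQuotientNormallyTerminal` follows from its
centralizer form "`Z_Ĝ(T̂) ⊆ T̂`" — the part whose printed proof (p. 59) uses `l`-cohomological
dimension, not available here. [cite: Mochizuki2012, Lem 2.7(v) p.59] -/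
theorem FreeOrSurface.zHatQuotientNormallyTerminal_of_centralizer_le
    (hZ : ∀ (G : Type u) [Group G], IsFreeOrSurface G →
      ∀ (T : Subgroup (profiniteCompletion G)), IsClosed (T : Set (profiniteCompletion G)) →
        (∃ φ : profiniteCompletion G →* ZHat, Continuous φ ∧ Function.Surjective φ ∧
          Function.Bijective (φ.comp T.subtype)) →
        Subgroup.centralizer (T : Set (profiniteCompletion G)) ≤ T) :
    FreeOrSurface.zHatQuotientNormallyTerminal.{u} := by
  intro G _ hG T hT hφ
  obtain ⟨φ, hφc, hφs, hφb⟩ := hφ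
  have hinj : Set.InjOn φ T := by
    intro a ha b hb hab
    have := hφb.1 (a₁ := ⟨a, ha⟩) (a₂ := ⟨b, hb⟩) (by simpa using hab)
    exact congrArg Subtype.val this
  apply le_antisymm
  · exact (normalizer_le_centralizer_of_injOn ZHat.mul_comm φ T hinj).trans
      (hZ G hG T hT ⟨φ, hφc, hφs, hφb⟩)
  · exact Subgroup.le_normalizer

/-! ### Theorem 2.6 (a), `H_G` cyclic: from conjugacy separability of `G` -/

section CyclicCase

variable {F : Type u} [Group F]

/-- Components of an element of `F̂` can be chosen coherently INSIDE a finite index subgroup `G` once the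
component at the normal core of `G` is trivial ("we may assume that `γ ∈ Ĝ`", p. 57): for every `N`
there is `c ∈ G` with `γ.val N = c·N`. [cite: Mochizuki2012, Thm 2.6 p.57] -/
theorem exists_mem_val_eq_mk_of_val_normalCore_eq_one (G : Subgroup F) [G.FiniteIndex]
    (γ : profiniteCompletion F)
    (hγ : γ.val (FiniteIndexNormalSubgroup.ofSubgroup G.normalCore) = 1)
    (N : FiniteIndexNormalSubgroup F) :
    ∃ c ∈ G, γ.val N = (QuotientGroup.mk c : F ⧸ N.toSubgroup) := by
  set N₀ : FiniteIndexNormalSubgroup F := FiniteIndexNormalSubgroup.ofSubgroup G.normalCore with hN₀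
  obtain ⟨c, hc⟩ := QuotientGroup.mk_surjective (γ.val (N ⊓ N₀))
  have hcN : γ.val N = (QuotientGroup.mk c : F ⧸ N.toSubgroup) :=
    ProfiniteCompletion.val_mk_eq_of_le γ inf_le_left c hc.symm
  have hcN₀ : γ.val N₀ = (QuotientGroup.mk c : F ⧸ N₀.toSubgroup) :=
    ProfiniteCompletion.val_mk_eq_of_le γ inf_le_right c hc.symm
  rw [hγ] at hcN₀
  have hc0 : c ∈ G.normalCore := by
    have := (QuotientGroup.eq_one_iff c).mp hcN₀.symm
    simpa [hN₀] using this
  exact ⟨c, G.normalCore_le hc0, hcN⟩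

/-- If `h₀ ∈ G` and `γ` as above conjugates `η(h₀)` to `η(g')`, then `g' ∈ G` (read off at the normal
core of `G`; p. 57 "`γ · H_G · γ⁻¹ ⊆ F ∩ Ĝ = G`"). [cite: Mochizuki2012, Thm 2.6 p.57] -/
theorem mem_of_conj_eq_of_val_normalCore_eq_one (G : Subgroup F) [G.FiniteIndex]
    (γ : profiniteCompletion F)
    (hγ : γ.val (FiniteIndexNormalSubgroup.ofSubgroup G.normalCore) = 1)
    {h₀ g' : F} (hh₀ : h₀ ∈ G) (hconj : γ * toCompletion F h₀ * γ⁻¹ = toCompletion F g') :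
    g' ∈ G := by
  set N₀ : FiniteIndexNormalSubgroup F := FiniteIndexNormalSubgroup.ofSubgroup G.normalCore with hN₀
  obtain ⟨c, hcG, hc⟩ := exists_mem_val_eq_mk_of_val_normalCore_eq_one G γ hγ N₀
  have h1 := ProfiniteCompletion.mk_conj_eq_of_conj_eq γ hconj N₀ c hc
  have h2 : (c * h₀ * c⁻¹)⁻¹ * g' ∈ G.normalCore := by
    have := QuotientGroup.eq.mp h1
    simpa [hN₀] using this
  have h3 : c * h₀ * c⁻¹ * ((c * h₀ * c⁻¹)⁻¹ * g') = g' := by group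
  rw [← h3]
  exact G.mul_mem (G.mul_mem (G.mul_mem hcG hh₀) (G.inv_mem hcG)) (G.normalCore_le h2)

/-- … and `h₀`, `g'` are conjugate in EVERY finite quotient of `G`: for `K ⊴ G` of finite index, read
the conjugation at the normal core (in `F`) of `K`. [cite: Mochizuki2012, Thm 2.6 p.57] -/
theorem isConj_mk_of_conj_eq_of_val_normalCore_eq_one (G : Subgroup F) [G.FiniteIndex]
    (γ : profiniteCompletion F)
    (hγ : γ.val (FiniteIndexNormalSubgroup.ofSubgroup G.normalCore) = 1)
    {h₀ g' : F} (hh₀ : h₀ ∈ G) (hg' : g' ∈ G)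
    (hconj : γ * toCompletion F h₀ * γ⁻¹ = toCompletion F g')
    (K : Subgroup G) [K.Normal] [K.FiniteIndex] :
    IsConj (QuotientGroup.mk (⟨h₀, hh₀⟩ : G) : G ⧸ K) (QuotientGroup.mk ⟨g', hg'⟩) := by
  -- the normal core in `F` of `K` (viewed in `F`) is a finite-index normal subgroup of `F` below `K`
  haveI : (K.map G.subtype).FiniteIndex := by
    constructor
    rw [Subgroup.index_map_subtype]
    exact mul_ne_zero Subgroup.FiniteIndex.index_ne_zero Subgroup.FiniteIndex.index_ne_zero
  set N : FiniteIndexNormalSubgroup F := FiniteIndexNormalSubgroup.ofSubgroup (K.map G.subtype).normalCore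
    with hN
  obtain ⟨c, hcG, hc⟩ := exists_mem_val_eq_mk_of_val_normalCore_eq_one G γ hγ N
  have h1 := ProfiniteCompletion.mk_conj_eq_of_conj_eq γ hconj N c hc
  have h2 : (c * h₀ * c⁻¹)⁻¹ * g' ∈ K.map G.subtype := by
    have := QuotientGroup.eq.mp h1
    exact Subgroup.normalCore_le _ (by simpa [hN] using this)
  -- pull back to `G`
  have h3 : (⟨c, hcG⟩ * ⟨h₀, hh₀⟩ * ⟨c, hcG⟩⁻¹ : G)⁻¹ * ⟨g', hg'⟩ ∈ K := by
    obtain ⟨k, hk, hk'⟩ := h2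
    have : k = (⟨c, hcG⟩ * ⟨h₀, hh₀⟩ * ⟨c, hcG⟩⁻¹ : G)⁻¹ * ⟨g', hg'⟩ := Subtype.ext (by simpa using hk')
    rw [← this]; exact hk
  refine isConj_iff.mpr ⟨QuotientGroup.mk ⟨c, hcG⟩, ?_⟩
  rw [← QuotientGroup.mk_mul, ← QuotientGroup.mk_inv, ← QuotientGroup.mk_mul]
  exact QuotientGroup.eq.mpr h3

/-- **Theorem 2.6 (a), `H_G = H ∩ G` cyclic, `G` conjugacy separable** — the core argument of
pp. 56–57 for an ARBITRARY group `F` with a finite index subgroup `G`: if `H_G` is cyclic and `G` is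
conjugacy separable (non-conjugate elements stay non-conjugate in some finite quotient), then any
`γ ∈ F̂` with `γ · η(h) · γ⁻¹ ∈ η(F)` for all `h ∈ H_G` satisfies
`γ · η(H_G) · γ⁻¹ = η(δ) · η(H_G) · η(δ)⁻¹` for some `δ ∈ F` ("`γ ∈ F · N_F̂(H_G)`").
[cite: Mochizuki2012, Thm 2.6 pp.56-57] -/
theorem conj_map_eq_of_isCyclic_of_conjSeparable (G H : Subgroup F) [G.FiniteIndex]
    (hcyc : IsCyclic (H ⊓ G : Subgroup F))
    (hCS : ∀ u v : G, ¬ IsConj u v →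
      ∃ (K : Subgroup G) (_ : K.Normal) (_ : K.FiniteIndex),
        ¬ IsConj (QuotientGroup.mk u : G ⧸ K) (QuotientGroup.mk v))
    (γ : profiniteCompletion F)
    (hγ : ∀ h ∈ H ⊓ G, γ * toCompletion F h * γ⁻¹ ∈ (toCompletion F).range) :
    ∃ δ : F, MulAut.conj γ • (H ⊓ G).map (toCompletion F) =
      MulAut.conj (toCompletion F δ) • (H ⊓ G).map (toCompletion F) := by
  -- a generator `h₀` of `H_G`
  obtain ⟨⟨h₀, hh₀⟩, hgen⟩ := hcyc.exists_generator
  have hHG : (H ⊓ G : Subgroup F) = Subgroup.zpowers h₀ := by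
    apply le_antisymm
    · intro x hx
      obtain ⟨k, hk⟩ := hgen ⟨x, hx⟩
      exact Subgroup.mem_zpowers_iff.mpr ⟨k, by simpa using congrArg Subtype.val hk⟩
    · rw [Subgroup.zpowers_le]; exact hh₀
  have hh₀G : h₀ ∈ G := (Subgroup.mem_inf.mp hh₀).2
  obtain ⟨g, hg⟩ := hγ h₀ hh₀
  -- Step 1: "multiplying `γ` on the left by an element of `F`, we may assume `γ ∈ Ĝ`"
  set N₀ : FiniteIndexNormalSubgroup F := FiniteIndexNormalSubgroup.ofSubgroup G.normalCore with hN₀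
  obtain ⟨f, hf⟩ := QuotientGroup.mk_surjective (γ.val N₀)
  set γ' : profiniteCompletion F := (toCompletion F f)⁻¹ * γ with hγ'
  have hγ'val : γ'.val N₀ = 1 := by
    change ((toCompletion F f).val N₀)⁻¹ * γ.val N₀ = 1
    rw [ProfiniteCompletion.toCompletion_val, ← hf]
    exact inv_mul_cancel _
  -- the conjugate of `η h₀` by `γ'` is `η (f⁻¹ g f)`
  set g' : F := f⁻¹ * g * f with hg'def
  have hconj' : γ' * toCompletion F h₀ * γ'⁻¹ = toCompletion F g' := by
    rw [hγ', mul_inv_rev, inv_inv, hg'def, map_mul, map_mul, map_inv]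
    have : (toCompletion F f)⁻¹ * γ * toCompletion F h₀ * (γ⁻¹ * toCompletion F f) =
        (toCompletion F f)⁻¹ * (γ * toCompletion F h₀ * γ⁻¹) * toCompletion F f := by group
    rw [this, ← hg]
  -- Step 2: `g' ∈ G`, and `h₀ ~ g'` in every finite quotient of `G`, hence in `G`
  have hg'G : g' ∈ G := mem_of_conj_eq_of_val_normalCore_eq_one G γ' hγ'val hh₀G hconj'
  have hconjG : IsConj (⟨h₀, hh₀G⟩ : G) ⟨g', hg'G⟩ := by
    by_contra hnc
    obtain ⟨K, hKn, hKf, hK⟩ := hCS _ _ hnc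
    exact hK (isConj_mk_of_conj_eq_of_val_normalCore_eq_one G γ' hγ'val hh₀G hg'G hconj' K)
  obtain ⟨ε, hε⟩ := isConj_iff.mp hconjG
  -- Step 3: `δ = f ε`
  refine ⟨f * (ε : F), ?_⟩
  have hε' : (ε : F) * h₀ * (ε : F)⁻¹ = g' := by
    have := congrArg Subtype.val hε
    simpa using this
  have hγh₀ : γ * toCompletion F h₀ * γ⁻¹ =
      toCompletion F (f * ε) * toCompletion F h₀ * (toCompletion F (f * ε))⁻¹ := by
    have e1 : γ = toCompletion F f * γ' := by rw [hγ']; group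
    rw [e1]
    have e2 : toCompletion F f * γ' * toCompletion F h₀ * (toCompletion F f * γ')⁻¹ =
        toCompletion F f * (γ' * toCompletion F h₀ * γ'⁻¹) * (toCompletion F f)⁻¹ := by group
    rw [e2, hconj', ← hε', map_mul, map_mul, map_mul, map_inv]
    group
  rw [hHG, MonoidHom.map_zpowers, Subgroup.pointwise_smul_def, Subgroup.pointwise_smul_def,
    MonoidHom.map_zpowers, MonoidHom.map_zpowers]
  change Subgroup.zpowers (γ * toCompletion F h₀ * γ⁻¹) =
    Subgroup.zpowers (toCompletion F (f * ε) * toCompletion F h₀ * (toCompletion F (f * ε))⁻¹)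
  rw [hγh₀]

end CyclicCase

/-! ### Theorem 2.6 (a), `H_G` abelian, `G` free of finite rank -/

/-- Conjugacy separability of free groups in the shape proved by abc-iut-L5-t14 ([Stb1] Theorem 1,
cited on p. 57), transported to any free group of finite rank and its finite quotients.
[cite: Mochizuki2012, Thm 2.6 p.57] -/
theorem conjSeparable_of_isFreeOfFiniteRank
    (hCS : ∀ (ι : Type u) (u v : FreeGroup ι), ¬ IsConj u v →
      ∃ (K : Subgroup (FreeGroup ι)) (_ : K.Normal) (_ : K.FiniteIndex),
        ¬ IsConj (QuotientGroup.mk u : FreeGroup ι ⧸ K) (QuotientGroup.mk v))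
    (G : Type u) [Group G] (hG : IsFreeOfFiniteRank G) (u v : G) (huv : ¬ IsConj u v) :
    ∃ (K : Subgroup G) (_ : K.Normal) (_ : K.FiniteIndex),
      ¬ IsConj (QuotientGroup.mk u : G ⧸ K) (QuotientGroup.mk v) := by
  haveI := FreeOrSurface.isFreeGroup_of_isFreeOfFiniteRank hG
  let e : G ≃* FreeGroup (IsFreeGroup.Generators G) := IsFreeGroup.toFreeGroup G
  have huv' : ¬ IsConj (e u) (e v) := fun h => huv (by simpa using e.symm.toMonoidHom.map_isConj h)
  obtain ⟨K, hKn, hKf, hK⟩ := hCS _ (e u) (e v) huv'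
  have hfi : (K.comap e.toMonoidHom).FiniteIndex := by
    constructor
    rw [Subgroup.index_comap_of_surjective _ e.surjective]
    exact Subgroup.FiniteIndex.index_ne_zero
  refine ⟨K.comap e.toMonoidHom, inferInstance, hfi, fun hc => hK ?_⟩
  · -- the quotient map `G ⧸ e⁻¹K → F ⧸ K` induced by `e`
    let q : G ⧸ K.comap e.toMonoidHom →* FreeGroup (IsFreeGroup.Generators G) ⧸ K :=
      QuotientGroup.map _ K e.toMonoidHom le_rfl
    have hq := q.map_isConj hc
    have h1 : q (QuotientGroup.mk u) = QuotientGroup.mk (e u) := rfl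
    have h2 : q (QuotientGroup.mk v) = QuotientGroup.mk (e v) := rfl
    rw [h1, h2] at hq
    exact hq

/-- **Theorem 2.6 (a) for `H_G` abelian and `G` free of finite rank**, relative to the conjugacy
separability of free groups ([Stb1] Thm 1, p. 57): with `F ⊇ G` of finite index, `G` free of finite
rank, `H ⊆ F` with `H_G = H ∩ G` abelian, and `γ ∈ F̂` conjugating `η(H)` into `η(F)`, one has
`γ · η(H_G) · γ⁻¹ = η(δ) · η(H_G) · η(δ)⁻¹` for some `δ ∈ F`.  (`H_G` is cyclic by Lemma 2.7 (iv);
the hypothesis "`H` infinite" of Theorem 2.6 is not needed for (a).)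
[cite: Mochizuki2012, Thm 2.6 pp.56-57] -/
theorem profiniteConjugates_a_abelian_freeCase_of_conjSeparable
    (hCS : ∀ (ι : Type u) (u v : FreeGroup ι), ¬ IsConj u v →
      ∃ (K : Subgroup (FreeGroup ι)) (_ : K.Normal) (_ : K.FiniteIndex),
        ¬ IsConj (QuotientGroup.mk u : FreeGroup ι ⧸ K) (QuotientGroup.mk v))
    (F : Type u) [Group F] (G H : Subgroup F) [G.FiniteIndex] (hG : IsFreeOfFiniteRank G)
    (hab : ∀ x ∈ H ⊓ G, ∀ y ∈ H ⊓ G, x * y = y * x)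
    (γ : profiniteCompletion F)
    (hγ : ∀ h ∈ H, γ * toCompletion F h * γ⁻¹ ∈ (toCompletion F).range) :
    ∃ δ : F, MulAut.conj γ • (H ⊓ G).map (toCompletion F) =
      MulAut.conj (toCompletion F δ) • (H ⊓ G).map (toCompletion F) := by
  -- `H_G` is cyclic: an abelian subgroup of the free group `G` (Lemma 2.7 (iv), free case)
  have hcyc : IsCyclic (H ⊓ G : Subgroup F) := by
    have h1 := FreeOrSurface.abelianSubgroupCyclic_freeCase G hG ((H ⊓ G).subgroupOf G)
      (fun a ha b hb => Subtype.ext (hab a ha b hb))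
    exact isCyclic_of_surjective (Subgroup.subgroupOfEquivOfLe (inf_le_right : H ⊓ G ≤ G)).toMonoidHom
      (Subgroup.subgroupOfEquivOfLe _).surjective
  exact conj_map_eq_of_isCyclic_of_conjSeparable G H hcyc
    (conjSeparable_of_isFreeOfFiniteRank hCS G hG) γ fun h hh => hγ h (Subgroup.mem_inf.mp hh).1

/-- Reduction for **Theorem 2.6**: the named statement `ProfiniteConjugatesOfDiscreteSubgroups` follows
from (1) conjugacy separability of free groups ([Stb1] Thm 1), (2) assertion (b) ("if `H_G` is nonabelian
then `γ ∈ F`") for `G` free of finite rank — whose printed proof uses Lemma 2.7 (iii) and (v) — and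
(3) the whole statement for `G` an orientable surface group; assertion (a) for `G` free then being
`profiniteConjugates_a_abelian_freeCase_of_conjSeparable` in the abelian case and a triviality in the
nonabelian case (take `δ` with `η(δ) = γ`). [cite: Mochizuki2012, Thm 2.6 pp.56-57] -/
theorem profiniteConjugatesOfDiscreteSubgroups_of_cases
    (hCS : ∀ (ι : Type u) (u v : FreeGroup ι), ¬ IsConj u v →
      ∃ (K : Subgroup (FreeGroup ι)) (_ : K.Normal) (_ : K.FiniteIndex),
        ¬ IsConj (QuotientGroup.mk u : FreeGroup ι ⧸ K) (QuotientGroup.mk v))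
    (hBfree : ∀ (F : Type u) [Group F] (G H : Subgroup F), G.FiniteIndex → IsFreeOfFiniteRank G →
      (H : Set F).Infinite → ∀ γ : profiniteCompletion F,
        (∀ h ∈ H, γ * toCompletion F h * γ⁻¹ ∈ (toCompletion F).range) →
        (∃ x ∈ H ⊓ G, ∃ y ∈ H ⊓ G, x * y ≠ y * x) → γ ∈ (toCompletion F).range)
    (hSurf : ∀ (F : Type u) [Group F] (G H : Subgroup F), G.FiniteIndex → IsOrientableSurfaceGroup G →
      (H : Set F).Infinite → ∀ γ : profiniteCompletion F,
        (∀ h ∈ H, γ * toCompletion F h * γ⁻¹ ∈ (toCompletion F).range) →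
        (∃ δ : F, MulAut.conj γ • (H ⊓ G).map (toCompletion F) =
            MulAut.conj (toCompletion F δ) • (H ⊓ G).map (toCompletion F)) ∧
        ((∃ x ∈ H ⊓ G, ∃ y ∈ H ⊓ G, x * y ≠ y * x) → γ ∈ (toCompletion F).range)) :
    ProfiniteConjugatesOfDiscreteSubgroups.{u} := by
  intro F _ G H hGfi hG hH γ hγ
  haveI := hGfi
  rcases hG with hF | hS
  · by_cases hab : ∀ x ∈ H ⊓ G, ∀ y ∈ H ⊓ G, x * y = y * x
    · refine ⟨profiniteConjugates_a_abelian_freeCase_of_conjSeparable hCS F G H hF hab γ hγ, ?_⟩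
      rintro ⟨x, hx, y, hy, hxy⟩
      exact absurd (hab x hx y hy) hxy
    · have hna : ∃ x ∈ H ⊓ G, ∃ y ∈ H ⊓ G, x * y ≠ y * x := by
        by_contra hne
        refine hab fun x hx y hy => ?_
        by_contra hxy
        exact hne ⟨x, hx, y, hy, hxy⟩
      have hb := hBfree F G H hGfi hF hH γ hγ hna
      refine ⟨?_, fun _ => hb⟩
      obtain ⟨δ, hδ⟩ := hb
      exact ⟨δ, by rw [hδ]⟩
  · exact hSurf F G H hGfi hS hH γ hγ

end Literature.IUT.HodgeTheaters
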